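import Summits.AtomisticToContinuum.FouriersLaw.Theorems.BondHeatUncertaintyBoundedResponseTotalBondComparison

/-!
# NODE 106 «ThoulessWindow» — the residual `(TCᶜ_3)` of the blocker `BoundedResponse` (11071) split at the transit time `aN` and the Thouless time `cN²`
(lens-1 «grading», gen 106; the door analysis asked by critic row 1446 (A)(2)(i); sequel of NODE 104 `…HeatSpreading{A,B,}` and NODE 105 `…TotalBondComparison`)

RESIDUAL MODE, branch `FouriersLaw`, blocker `BondHeatUncertainty.BoundedResponse` (stmt-AtomisticToContinuum-11071) `⟺ OhmicFloor ⟺ G_N = O(N)`.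
Residual of record beneath the route crux (S) `SubdiffusiveBondHeat` (9120): `(TCᶜ_3) = GKTailCeiling 3`, `Tr_N(cN²) ≤ C·N³` for every `c > 0`, where
`Tr_N(t) = ∫_{(0,∞)} min(s,t) C_N(s) ds`, `C_N(s) = ∫ J·(P_sJ) dμ_T`, `J = ∑_i j_i` (NODE 104), and `(S) ⟹ (11071 ⟺ TCᶜ_3)` (NODE 105,
`boundedResponse_iff_gkTailCeiling_three_of_subdiffusiveBondHeat`).  Currency: VERBATIM `totalAutocorr`, `gkTail`, `totalGK`, `heatSpread`, `GKTailCeiling` of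
NODE 104, plus TWO named functionals of the same scalar function `C_N`:

* the REMAINING GREEN–KUBO TAIL `R_N(t) := ∫_{(t,∞)} C_N` (`gkRemainder`; `R_N(0) = G_N`, `G_N = ∫_{(0,t]} C_N + R_N(t)`: `totalGK_eq_integral_add_gkRemainder`);
* the WINDOWED FIRST MOMENT `M_N(t₁,t₂) := ∫_{(t₁,t₂]} s·C_N(s) ds` (`gkMoment`).

THE SPLIT (fixed-`N` real analysis, `0 ≤ t₁ ≤ t₂`; `gkTail_eq_gkMoment_add`, `gkMoment_split`, `gkTail_eq_early_add_late_add_tail`):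

  `Tr_N(t) = M_N(0,t) + t·R_N(t)`      and      `Tr_N(t₂) = M_N(0,t₁) + M_N(t₁,t₂) + t₂·R_N(t₂)`.

With `t₁ = aN` (any multiple of the TRANSIT time of the chain) and `t₂ = cN²` (the THOULESS time) the early moment is FREE at the sharp grade:
`|M_N(0,aN)| ≤ ‖J‖²_{μ_T}·(aN)²/2 ≤ (C_J a²/2)·N³` (`abs_gkMoment_le`; kernel contraction `|C_N| ≤ ‖J‖² ≤ C_J N`).  Hence the door of this node:

  ★ `GKTailCeiling 3 ⟺ PostTransitCeiling 3`   (`gkTailCeiling_three_iff_postTransitCeiling_three`),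

  (PTᶜ_3) `∀ a, c > 0: M_N(aN, cN²) + cN²·R_N(cN²) ≤ C·N³` eventually in `N` — «past the transit time, the late first moment of the total-current
  autocorrelation plus the Thouless-time remainder of the Green–Kubo integral is `O(N³)`».  THE ENTIRE CONTENT OF THE RESIDUAL LIVES IN THE POST-TRANSIT
  WINDOW `s ≥ aN` OF ONE SCALAR FUNCTION; nothing about `C_N` on `[0, aN]` — where `G_N` is made — is asked.  (PTᶜ_3) is the residual RE-LOCALISED
  (EQUIV, not a new piece).  Its two summands are the critic's pre-Thouless and post-Thouless pieces with the free early part removed: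

* (LMᶜ_g) `LateMomentCeiling g`: `∃ a > 0 ∀ c > 0: M_N(aN,cN²) ≤ C·N^g` — the PRE-THOULESS MOMENT past the light cone;
* (TTᶜ_g) `ThoulessTailCeiling g`: `∀ c > 0: cN²·R_N(cN²) ≤ C·N^g` — the POST-THOULESS TAIL (`R_N(cN²) = O(N^{g−2})`);
  SEAMS (PROVED): `LM_g ∧ TT_{g'} ⟹ TC_{max(3,g,g')}` (`gkTailCeiling_of_lateMoment_thoulessTail`), in particular `LM_3 ∧ TT_3 ⟹ TC_3 (⟺ PT_3)`;
  NECESSITY modulo the opposite floor (PROVED): `PT_3 ∧ ThoulessTailFloor 3 ⟹ LM_3` and `PT_3 ∧ LateMomentFloor 3 ⟹ TT_3`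
  (`lateMomentCeiling_three_of_postTransit_tailFloor`, `thoulessTailCeiling_three_of_postTransit_momentFloor`); `11071 ⟹ PT_3`
  (`postTransitCeiling_three_of_boundedResponse`).  Free rungs (PROVED): `LM_5`, `TT_5` (`lateMomentCeiling_five`, `thoulessTailCeiling_five`).
  ANSWER to 1446 (i) «bound the pre-Thouless moment by (S)-type inputs if possible — say which»: NONE does.  Spreading inputs bound `V_N(t) = 2∫₀ᵗ(t−s)C_N`
  from ABOVE, and `M_N(0,t) = t·∫_{(0,t]}C_N − V_N(t)/2` (`gkMoment_zero_eq`), so (S)/(HSᴾ)-type ceilings bound the first moment from BELOW only; its early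
  part needs nothing (free) and its late part `M_N(aN,cN²)` is controlled by post-transit DECAY of `C_N`, not by spreading.

* GRADED SUFFICIENT DECAY PIECES (windowed, pointwise, on the one observable `C_N`; seams PROVED, grades exact in the exponents):
  (PTDᶜ_{p,α}) `PostTransitDecay p α`: `∃ a > 0, A, N₀: ∀ N ≥ N₀, ∀ s ≥ aN: |C_N(s)| ≤ A·N^p·s^{−α}`.  `α < 2 ⟹ LM_{p+4−2α}`
    (`lateMomentCeiling_of_postTransitDecay`), `α > 1 ⟹ TT_{p+4−2α}` (`thoulessTailCeiling_of_postTransitDecay`), so for `1 < α < 2`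
    `PTD_{p,α} ⟹ TC_{max(3, p+4−2α)}` (`gkTailCeiling_of_postTransitDecay`); grade-3 frontier `p ≤ 2α − 1` (`gkTailCeiling_three_of_postTransitDecay`),
    e.g. `(p,α) = (1, 1+ε)`: «past the transit time the total-current autocorrelation is below its trivial size `C_J N` by the factor `s^{−1−ε}`» suffices,
    with (S), for 11071 (`boundedResponse_of_subdiffusiveBondHeat_postTransitDecay`).
  (PTGᶜ_p) `PostTransitGapDecay p`: `∃ a, κ > 0, A, N₀: ∀ N ≥ N₀, ∀ s ≥ aN: |C_N(s)| ≤ A·N^p·e^{−κs/N²}` — the critic's «energy-mode gap `κ/N²` × amplitude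
    `N^p`» member, typed WITHOUT a spectral gap (windowed decay of one autocorrelation; the generator is non-normal and its `L²` gap
    closes — g105 memo; `Literature.Barriers.AtomisticToContinuum.SpectralGapClosingEquilibrium`).  `PTG_p ⟹ LM_{p+4} ∧ TT_{p+4} ⟹ TC_{max(3,p+4)}`
    (`gkTailCeiling_of_postTransitGapDecay`); THE RESULTING GRADE IS `p + 4`: grade 3 needs AMPLITUDE `p ≤ −1`, i.e. `|C_N(s)| ≤ (A/N)·e^{−κs/N²}` past
    the transit time (`gkTailCeiling_three_of_postTransitGapDecay`, `boundedResponse_of_subdiffusiveBondHeat_postTransitGapDecay`).  Amplitude `N^a`,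
    `a > −1`, at the gap rate gives only `TC_{a+4}`: the gap ALONE never reaches grade 3 — the amplitude statement «the slow (hydrodynamic) part of the TOTAL
    current has weight `O(1/N)` at the transit time» is the load-bearing half.

HEURISTIC STATUS (fluctuating hydrodynamics of the diffusive phase; harmonic normal modes with boundary damping `Γ_k ≍ γ v_k²/N` and the current ECHO
oscillation at the round-trip frequencies `≍ v_k/N` — g105 memo LIT §3, this node's memo §3):
  diffusive truth: `J = ∑ j_i` is, up to a fast (mean-free-time) part of size `‖J‖² ≍ N`, the boundary energy imbalance `−D(e_R − e_L)`, whose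
  autocorrelation has `N`-INDEPENDENT amplitude and decays like `s^{−3/2}` (Robin boundary Green function) until the diffusive cutoff `e^{−Dπ²s/N²}`:
  `(p,α) ≈ (0, 3/2)`, grade `1`, two below the sharp grade `3` — so `TC_3`, `PT_3`, `LM_3`, `TT_3`, `PTD_{1,1+ε}`, `PTD_{2,3/2}`, `PTG_{−1}` are all
  TRUE-leaning with room; harmonic member (RLL ballistic control: modes damped only at the ends, current-reversing echoes): `|C_N^{harm}|` is of
  order `N` on `[aN, 2aN]`, `G^{harm} ≍ N²`, and `Tr^{harm}(cN²) = O(N³)` is expected (g105 LIT §3), so `TC_3`, `PT_3`, `LM_3`, `TT_3` are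
  phonon-COMPATIBLE at the margin (they see the anharmonic bulk only JOINTLY with (S), which is phonon-false); every grade-3 member of (PTD) (`p − α < 1`) and
  of (PTG) (`p ≤ −1`) is phonon-FALSE (`|C^{harm}(aN)| ≍ N`): THESE are the pieces that must use anharmonicity.
TAGS: (PTᶜ_3) EQUIV (= residual, re-localised) · (LMᶜ_3), (TTᶜ_3) WEAKER (each implied by 11071 modulo a floor; neither constrains `G_N`), UNDECIDED,
INSTRUMENTABLE (census GKTAIL-105 plus the two functionals, memo §4) · grade-3 (PTDᶜ), (PTGᶜ_{−1}): WEAKER in information («nothing before `aN`»),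
STRONGER in form (pointwise), UNDECIDED, phonon-FALSE, ATTACKABLE (coupling / hypocoercive decay for ONE observable past the light cone; IDEA-NEEDED for the
amplitude `1/N`).  COSTUME CHECK: no piece of this file is equivalent to 11071 or to `G_N = O(N)`: every hypothesis `Prop` constrains `C_N` only on `s ≥ aN`
(`LM`, `PTD`, `PTG`) or `s ≥ cN²` (`TT`), while `G_N − R_N(aN) = ∫_{(0,aN]} C_N` is left free (free bound `C_J a N²`, one order above Ohmic); the probes
`MustFail106` record that none of them yields `BoundedResponse` by `exact?`/`aesop`.
WHY NOVEL (w.r.t. the tree and print): the tree's Green–Kubo statements (`CorrectorTheory`, NODE 104/105, `TransientBand`) are whole-half-line functionals;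
this node proves that the blocker's residual is decided in the window `[aN, ∞)` alone and converts it into graded POINTWISE decay targets for one
autocorrelation, with the gap × amplitude bookkeeping made exact (`grade = p + 4` at rate `κ/N²`, `= p + 4 − 2α` for algebraic decay) — no windowed statement
of this kind for the open anharmonic chain is in print (memo §5; nulls recorded).  WHY NO PIECE IS THE TARGET IN DISGUISE: `11071 ⟹ TC_3 ⟺ PT_3`
(tree + ★) and `PT_3 ∧ floor ⟹ LM_3, TT_3` are PROVED here (necessary pieces), while no converse holds on the class of integrable `C` modified on
`[0, aN]` (memo §2 — a class argument, not a theorem about the chain); the decay pieces (PTD), (PTG) are INCOMPARABLE with 11071: sufficient only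
JOINTLY with (S) (proved), not sufficient alone (`C_N` free before `aN`), not necessary (an integral bound implies no pointwise decay).  Everything here
is sorry-free real analysis over tree objects; the `Prop`s are hypotheses, nothing closes an item.  Tags: hypothesis `Prop`s carry «[route statement ·
this cell; NOT a literature fact]»; [folklore] on objects and seams, [formal bookkeeping] on the `_tw` helpers.
-/

noncomputable section

open MeasureTheory ProbabilityTheory Filter Topology Set Function
open scoped NNReal ENNReal
open Literature.MathematicalPhysics.KineticTheory.HeatConduction
open Literature.MathematicalPhysics.KineticTheory OscillatorChain
open Summit.AtomisticToContinuum.FouriersLaw.Theorems.SubdiffusiveBondHeat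
open Summit.AtomisticToContinuum.FouriersLaw.Theorems.SubdiffusiveBondHeat.EscapeGrading
open Summit.AtomisticToContinuum.FouriersLaw.Theorems.OddSectorIrreversibility

namespace Summit.AtomisticToContinuum.FouriersLaw.Theorems.BoundedResponse.HeatSpreading

open Summit.AtomisticToContinuum.FouriersLaw.Theses.BondHeatUncertainty (BoundedResponse SubdiffusiveBondHeat)
open Summit.AtomisticToContinuum.FouriersLaw.Theorems.BoundedResponse.ParityFloor (exists_integral_totalCurrent_sq_gibbsMeasure_le)

/-! ## §0 The two functionals -/

/-- **The remaining Green–Kubo tail `R_N(t) = ∫_{(t,∞)} C_N(s) ds`** (`R_N(0) = G_N`; `t·R_N(t)` at `t = cN²` is the post-Thouless piece of `Tr_N`).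
[folklore] -/
def gkRemainder (ω₂ lam β γ T : ℝ) (N : ℕ) (t : ℝ) : ℝ :=
  ∫ s in Ioi t, totalAutocorr ω₂ lam β γ T N s

/-- **The windowed first moment `M_N(t₁,t₂) = ∫_{(t₁,t₂]} s·C_N(s) ds`** (`M_N(0,t)` is the pre-`t` first moment of the total-current autocorrelation).
[folklore] -/
def gkMoment (ω₂ lam β γ T : ℝ) (N : ℕ) (t₁ t₂ : ℝ) : ℝ :=
  ∫ s in Ioc t₁ t₂, s * totalAutocorr ω₂ lam β γ T N s

/-! ## §1 Real-exponent bookkeeping (public, suffix `_tw`, so that a landing cut into several files can share them) -/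

/-- `x ^ (3 : ℝ) = x ^ 3`. [formal bookkeeping] (lane edit hand-2 g38: ONE `private` token — `dedup.landed` vs
`Literature.MathematicalPhysics.QuantumFieldTheory.DimockYuan2024.FirstLinearEquation.rpow_three_eq`; part B carries a private twin.) -/
private theorem rpow_three_tw (x : ℝ) : x ^ (3 : ℝ) = x ^ 3 := by
  rw [show (3 : ℝ) = ((3 : ℕ) : ℝ) by norm_num, Real.rpow_natCast]

/-- `x ^ (5 : ℝ) = x ^ 5`. [formal bookkeeping] -/
theorem rpow_five_tw (x : ℝ) : x ^ (5 : ℝ) = x ^ 5 := by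
  rw [show (5 : ℝ) = ((5 : ℕ) : ℝ) by norm_num, Real.rpow_natCast]

/-- `(c·x²)^e = c^e · x^(2e)` for `c, x ≥ 0`. [formal bookkeeping] -/
theorem mul_sq_rpow_tw {c x : ℝ} (hc : 0 ≤ c) (hx : 0 ≤ x) (e : ℝ) : (c * x ^ 2) ^ e = c ^ e * x ^ (2 * e) := by
  rw [Real.mul_rpow hc (pow_nonneg hx 2), ← Real.rpow_two, ← Real.rpow_mul hx]

/-- Grade comparison: `K·N^u ≤ max K 0 · N^v` for `u ≤ v`, `N ≥ 1`. [formal bookkeeping] -/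
theorem mul_rpow_le_max_mul_rpow_tw {K u v x : ℝ} (hx : 1 ≤ x) (huv : u ≤ v) : K * x ^ u ≤ max K 0 * x ^ v :=
  calc K * x ^ u ≤ max K 0 * x ^ u := mul_le_mul_of_nonneg_right (le_max_left _ _) (Real.rpow_nonneg (by linarith) u)
    _ ≤ max K 0 * x ^ v := mul_le_mul_of_nonneg_left (Real.rpow_le_rpow_of_exponent_le hx huv) (le_max_right _ _)

/-- The window is non-empty eventually: `aN ≤ cN²` once `N ≥ ⌈a/c⌉`. [formal bookkeeping] -/
theorem window_le_tw {a c : ℝ} (hc : 0 < c) {N : ℕ} (hN : ⌈a / c⌉₊ ≤ N) : a * (N : ℝ) ≤ c * (N : ℝ) ^ 2 := by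
  have h1 : a / c ≤ (N : ℝ) := le_trans (Nat.le_ceil _) (by exact_mod_cast hN)
  have h2 : a ≤ (N : ℝ) * c := (div_le_iff₀ hc).1 h1
  have hN0 : (0 : ℝ) ≤ N := Nat.cast_nonneg N
  nlinarith

section FixedN

variable {ω₂ lam β γ T : ℝ} (hω : 0 < ω₂) (hl : 0 < lam) (hβ : 0 < β) (hγ : 0 < γ) (hT : 0 < T)
include hω hl hβ hγ hT

/-! ## §2 Fixed-`N` real analysis of `C_N ∈ L¹(0,∞)`, `|C_N| ≤ ‖J‖²` -/

/-- `s ↦ s·C_N(s)` is integrable on `(t₁,t₂]` for `t₁ ≥ 0` (`N ≥ 1`). [folklore] -/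
theorem integrableOn_mul_totalAutocorr {N : ℕ} (hN : 0 < N) {t₁ : ℝ} (t₂ : ℝ) (ht₁ : 0 ≤ t₁) :
    IntegrableOn (fun s => s * totalAutocorr ω₂ lam β γ T N s) (Ioc t₁ t₂) := by
  have hC : IntegrableOn (totalAutocorr ω₂ lam β γ T N) (Ioc t₁ t₂) :=
    (integrableOn_totalAutocorr hω hl hβ hγ hT hN).mono_set fun s hs => lt_of_le_of_lt ht₁ hs.1
  refine Integrable.bdd_mul (c := |t₂|) hC measurable_id.aestronglyMeasurable ?_
  refine ae_restrict_of_forall_mem measurableSet_Ioc fun s hs => ?_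
  rw [Real.norm_eq_abs]
  exact abs_le_abs_of_nonneg (by linarith [hs.1]) hs.2

/-- **`G_N = ∫_{(0,t]} C_N + R_N(t)`** for `t ≥ 0` (`N ≥ 1`). [folklore] -/
theorem totalGK_eq_integral_add_gkRemainder {N : ℕ} (hN : 0 < N) {t : ℝ} (ht : 0 ≤ t) :
    totalGK ω₂ lam β γ T N = (∫ s in Ioc 0 t, totalAutocorr ω₂ lam β γ T N s) + gkRemainder ω₂ lam β γ T N t := by
  have hCi := integrableOn_totalAutocorr hω hl hβ hγ hT hN
  unfold totalGK gkRemainder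
  rw [← Ioc_union_Ioi_eq_Ioi ht, setIntegral_union (Ioc_disjoint_Ioi le_rfl) measurableSet_Ioi
    (hCi.mono_set Ioc_subset_Ioi_self) (hCi.mono_set (Ioi_subset_Ioi ht))]

/-- **The split `Tr_N(t) = M_N(0,t) + t·R_N(t)`** for `t ≥ 0` (`N ≥ 1`): `min(s,t) = s` on `(0,t]`, `= t` on `(t,∞)`. [folklore] -/
theorem gkTail_eq_gkMoment_add {N : ℕ} (hN : 0 < N) {t : ℝ} (ht : 0 ≤ t) :
    gkTail ω₂ lam β γ T N t = gkMoment ω₂ lam β γ T N 0 t + t * gkRemainder ω₂ lam β γ T N t := by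
  have hCi := integrableOn_totalAutocorr hω hl hβ hγ hT hN
  have hpt : EqOn (fun s => min s t * totalAutocorr ω₂ lam β γ T N s)
      (fun s => (Iic t).indicator (fun s => s * totalAutocorr ω₂ lam β γ T N s) s +
        t * (Ioi t).indicator (totalAutocorr ω₂ lam β γ T N) s) (Ioi 0) := by
    intro s _
    by_cases h : s ≤ t
    · simp only [indicator_of_mem (show s ∈ Iic t from h), indicator_of_notMem (show s ∉ Ioi t from not_lt.2 h),
        min_eq_left h, mul_zero, add_zero]
    · have h' : t < s := lt_of_not_ge h
      simp only [indicator_of_notMem (show s ∉ Iic t from h), indicator_of_mem (show s ∈ Ioi t from h'),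
        min_eq_right h'.le, zero_add]
  have hi1 : IntegrableOn (fun s => (Iic t).indicator (fun s => s * totalAutocorr ω₂ lam β γ T N s) s) (Ioi 0) := by
    rw [IntegrableOn, integrable_indicator_iff measurableSet_Iic, IntegrableOn, Measure.restrict_restrict measurableSet_Iic,
      Iic_inter_Ioi]
    exact integrableOn_mul_totalAutocorr hω hl hβ hγ hT hN t le_rfl
  have hi2' : IntegrableOn ((Ioi t).indicator (totalAutocorr ω₂ lam β γ T N)) (Ioi 0) := by
    rw [IntegrableOn, integrable_indicator_iff measurableSet_Ioi, IntegrableOn, Measure.restrict_restrict measurableSet_Ioi]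
    exact hCi.mono_set inter_subset_right
  have hi2 : IntegrableOn (fun s => t * (Ioi t).indicator (totalAutocorr ω₂ lam β γ T N) s) (Ioi 0) := hi2'.const_mul t
  unfold gkTail gkMoment gkRemainder
  rw [setIntegral_congr_fun measurableSet_Ioi hpt, integral_add hi1 hi2, integral_const_mul,
    setIntegral_indicator measurableSet_Iic, setIntegral_indicator measurableSet_Ioi, Ioi_inter_Iic, Ioi_inter_Ioi,
    sup_of_le_right ht]

/-- **Window additivity `M_N(0,t₂) = M_N(0,t₁) + M_N(t₁,t₂)`** for `0 ≤ t₁ ≤ t₂` (`N ≥ 1`). [folklore] -/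
theorem gkMoment_split {N : ℕ} (hN : 0 < N) {t₁ t₂ : ℝ} (h₁ : 0 ≤ t₁) (h₁₂ : t₁ ≤ t₂) :
    gkMoment ω₂ lam β γ T N 0 t₂ = gkMoment ω₂ lam β γ T N 0 t₁ + gkMoment ω₂ lam β γ T N t₁ t₂ := by
  unfold gkMoment
  rw [← Ioc_union_Ioc_eq_Ioc h₁ h₁₂, setIntegral_union (Ioc_disjoint_Ioc_of_le le_rfl) measurableSet_Ioc
    (integrableOn_mul_totalAutocorr hω hl hβ hγ hT hN t₁ le_rfl) (integrableOn_mul_totalAutocorr hω hl hβ hγ hT hN t₂ h₁)]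

/-- **The light-cone/Thouless split `Tr_N(t₂) = M_N(0,t₁) + M_N(t₁,t₂) + t₂·R_N(t₂)`** for `0 ≤ t₁ ≤ t₂` (`N ≥ 1`): early moment + late moment +
remaining tail. [folklore] -/
theorem gkTail_eq_early_add_late_add_tail {N : ℕ} (hN : 0 < N) {t₁ t₂ : ℝ} (h₁ : 0 ≤ t₁) (h₁₂ : t₁ ≤ t₂) :
    gkTail ω₂ lam β γ T N t₂ =
      gkMoment ω₂ lam β γ T N 0 t₁ + gkMoment ω₂ lam β γ T N t₁ t₂ + t₂ * gkRemainder ω₂ lam β γ T N t₂ := by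
  rw [gkTail_eq_gkMoment_add hω hl hβ hγ hT hN (h₁.trans h₁₂), gkMoment_split hω hl hβ hγ hT hN h₁ h₁₂]

/-- **`M_N(0,t) = t·∫_{(0,t]} C_N − V_N(t)/2`** (`t ≥ 0`, `N ≥ 1`): the first moment in spreading currency — spreading CEILINGS bound it from BELOW only
(the answer to «bound the pre-Thouless moment by (S)-type inputs»: not possible). [folklore] -/
theorem gkMoment_zero_eq {N : ℕ} (hN : 0 < N) {t : ℝ} (ht : 0 ≤ t) :
    gkMoment ω₂ lam β γ T N 0 t = t * (∫ s in Ioc 0 t, totalAutocorr ω₂ lam β γ T N s) - heatSpread ω₂ lam β γ T N t / 2 := by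
  have h1 := gkTail_eq_gkMoment_add hω hl hβ hγ hT hN ht
  have h2 := mul_totalGK_eq hω hl hβ hγ hT hN ht
  have h3 := totalGK_eq_integral_add_gkRemainder hω hl hβ hγ hT hN ht
  have h4 : t * totalGK ω₂ lam β γ T N = t * (∫ s in Ioc 0 t, totalAutocorr ω₂ lam β γ T N s) + t * gkRemainder ω₂ lam β γ T N t := by
    rw [h3, mul_add]
  linarith

/-- **`|∫_{(t₁,t₂]} C_N| ≤ ‖J‖²_{μ_T}·(t₂ − t₁)`** for `t₁ ≤ t₂` (`N ≥ 1`; kernel contraction). [folklore] -/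
theorem abs_integral_Ioc_totalAutocorr_le {N : ℕ} (hN : 0 < N) {t₁ t₂ : ℝ} (h : t₁ ≤ t₂) :
    |∫ s in Ioc t₁ t₂, totalAutocorr ω₂ lam β γ T N s| ≤
      (∫ z, (∑ i : Fin N, (pinnedChain ω₂ lam β γ).bondCurrent N i z) ^ 2 ∂((pinnedChain ω₂ lam β γ).gibbsMeasure N T)) * (t₂ - t₁) := by
  set M := ∫ z, (∑ i : Fin N, (pinnedChain ω₂ lam β γ).bondCurrent N i z) ^ 2 ∂((pinnedChain ω₂ lam β γ).gibbsMeasure N T) with hM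
  have hb : ∀ᵐ s ∂(volume.restrict (Ioc t₁ t₂)), ‖totalAutocorr ω₂ lam β γ T N s‖ ≤ M :=
    ae_of_all _ fun s => by rw [Real.norm_eq_abs]; exact abs_totalAutocorr_le hω hl hβ hγ hT hN s
  have hgi : IntegrableOn (fun _ : ℝ => M) (Ioc t₁ t₂) := continuous_const.integrableOn_Ioc
  have h' := norm_integral_le_of_norm_le hgi hb
  rw [Real.norm_eq_abs, setIntegral_const, measureReal_def, Real.volume_Ioc, ENNReal.toReal_ofReal (by linarith), smul_eq_mul] at h'
  linarith

/-- **`|M_N(t₁,t₂)| ≤ ‖J‖²_{μ_T}·(t₂² − t₁²)/2`** for `0 ≤ t₁ ≤ t₂` (`N ≥ 1`): the free bound on any windowed moment; at `(0, aN)` it is `≤ C_J a² N³/2` — the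
early moment is free at grade 3. [folklore] -/
theorem abs_gkMoment_le {N : ℕ} (hN : 0 < N) {t₁ t₂ : ℝ} (h₁ : 0 ≤ t₁) (h₁₂ : t₁ ≤ t₂) :
    |gkMoment ω₂ lam β γ T N t₁ t₂| ≤
      (∫ z, (∑ i : Fin N, (pinnedChain ω₂ lam β γ).bondCurrent N i z) ^ 2 ∂((pinnedChain ω₂ lam β γ).gibbsMeasure N T)) *
        ((t₂ ^ 2 - t₁ ^ 2) / 2) := by
  set M := ∫ z, (∑ i : Fin N, (pinnedChain ω₂ lam β γ).bondCurrent N i z) ^ 2 ∂((pinnedChain ω₂ lam β γ).gibbsMeasure N T) with hM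
  have hb : ∀ᵐ s ∂(volume.restrict (Ioc t₁ t₂)), ‖s * totalAutocorr ω₂ lam β γ T N s‖ ≤ s * M := by
    refine ae_restrict_of_forall_mem measurableSet_Ioc fun s hs => ?_
    have hs0 : 0 ≤ s := by linarith [hs.1]
    rw [Real.norm_eq_abs, abs_mul, abs_of_nonneg hs0]
    exact mul_le_mul_of_nonneg_left (abs_totalAutocorr_le hω hl hβ hγ hT hN s) hs0
  have hgi : IntegrableOn (fun s : ℝ => s * M) (Ioc t₁ t₂) := (continuous_id.mul continuous_const).integrableOn_Ioc
  have h' := norm_integral_le_of_norm_le hgi hb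
  rw [Real.norm_eq_abs] at h'
  have hval : ∫ s in Ioc t₁ t₂, s * M = M * ((t₂ ^ 2 - t₁ ^ 2) / 2) := by
    rw [← intervalIntegral.integral_of_le h₁₂, intervalIntegral.integral_mul_const, integral_id]
    ring
  unfold gkMoment
  rw [← hval]
  exact h'

/-- **`−‖J‖²t ≤ R_N(t) ≤ γT²(N−1)² + ‖J‖²t`** for `t ≥ 0`, `N ≥ 2` (`0 ≤ G_N ≤ γT²(N−1)²` and the contraction bound on `∫_{(0,t]} C_N`). [folklore] -/
theorem gkRemainder_bounds {N : ℕ} (hN : 2 ≤ N) {t : ℝ} (ht : 0 ≤ t) :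
    -((∫ z, (∑ i : Fin N, (pinnedChain ω₂ lam β γ).bondCurrent N i z) ^ 2 ∂((pinnedChain ω₂ lam β γ).gibbsMeasure N T)) * t) ≤
        gkRemainder ω₂ lam β γ T N t ∧
      gkRemainder ω₂ lam β γ T N t ≤ γ * T ^ 2 * ((N : ℝ) - 1) ^ 2 +
        (∫ z, (∑ i : Fin N, (pinnedChain ω₂ lam β γ).bondCurrent N i z) ^ 2 ∂((pinnedChain ω₂ lam β γ).gibbsMeasure N T)) * t := by
  have hN0 : 0 < N := by omega
  have hsplit := totalGK_eq_integral_add_gkRemainder hω hl hβ hγ hT hN0 ht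
  have hI := abs_integral_Ioc_totalAutocorr_le hω hl hβ hγ hT hN0 ht
  rw [sub_zero] at hI
  obtain ⟨hG0, hG1⟩ := totalGK_nonneg_and_le hω hl hβ hγ hT hN
  obtain ⟨hI1, hI2⟩ := abs_le.1 hI
  constructor <;> linarith

/-- **Comparison for the late moment**: if `|C_N| ≤ φ` on `(t₁,t₂]` (`t₁ ≥ 0`) with `s·φ(s)` integrable there, then `M_N(t₁,t₂) ≤ ∫_{(t₁,t₂]} s·φ(s) ds`.
[folklore] -/
theorem gkMoment_le_of_abs_le {N : ℕ} (hN : 0 < N) {t₁ t₂ : ℝ} (h₁ : 0 ≤ t₁) {φ : ℝ → ℝ}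
    (hφi : IntegrableOn (fun s => s * φ s) (Ioc t₁ t₂)) (hφ : ∀ s ∈ Ioc t₁ t₂, |totalAutocorr ω₂ lam β γ T N s| ≤ φ s) :
    gkMoment ω₂ lam β γ T N t₁ t₂ ≤ ∫ s in Ioc t₁ t₂, s * φ s := by
  unfold gkMoment
  refine setIntegral_mono_on (integrableOn_mul_totalAutocorr hω hl hβ hγ hT hN t₂ h₁) hφi measurableSet_Ioc fun s hs => ?_
  have hs0 : 0 ≤ s := by linarith [hs.1]
  calc s * totalAutocorr ω₂ lam β γ T N s ≤ |s * totalAutocorr ω₂ lam β γ T N s| := le_abs_self _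
    _ = s * |totalAutocorr ω₂ lam β γ T N s| := by rw [abs_mul, abs_of_nonneg hs0]
    _ ≤ s * φ s := mul_le_mul_of_nonneg_left (hφ s hs) hs0

/-- **Crude comparison for the late moment**: if `|C_N| ≤ φ` on `(t₁,t₂]` (`t₁ ≥ 0`) with `φ ≥ 0` integrable on `(t₁,∞)`, then
`M_N(t₁,t₂) ≤ t₂·∫_{(t₁,∞)} φ`. [folklore] -/
theorem gkMoment_le_mul_of_abs_le {N : ℕ} (hN : 0 < N) {t₁ t₂ : ℝ} (h₁ : 0 ≤ t₁) (h₁₂ : t₁ ≤ t₂) {φ : ℝ → ℝ}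
    (hφi : IntegrableOn φ (Ioi t₁)) (hφ0 : ∀ s ∈ Ioi t₁, 0 ≤ φ s) (hφ : ∀ s ∈ Ioc t₁ t₂, |totalAutocorr ω₂ lam β γ T N s| ≤ φ s) :
    gkMoment ω₂ lam β γ T N t₁ t₂ ≤ t₂ * ∫ s in Ioi t₁, φ s := by
  have ht₂ : 0 ≤ t₂ := h₁.trans h₁₂
  have hφi' : IntegrableOn φ (Ioc t₁ t₂) := hφi.mono_set Ioc_subset_Ioi_self
  have h1 : gkMoment ω₂ lam β γ T N t₁ t₂ ≤ ∫ s in Ioc t₁ t₂, t₂ * φ s := by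
    unfold gkMoment
    refine setIntegral_mono_on (integrableOn_mul_totalAutocorr hω hl hβ hγ hT hN t₂ h₁) (hφi'.const_mul t₂) measurableSet_Ioc
      fun s hs => ?_
    have hs0 : 0 ≤ s := by linarith [hs.1]
    calc s * totalAutocorr ω₂ lam β γ T N s ≤ |s * totalAutocorr ω₂ lam β γ T N s| := le_abs_self _
      _ = s * |totalAutocorr ω₂ lam β γ T N s| := by rw [abs_mul, abs_of_nonneg hs0]
      _ ≤ s * φ s := mul_le_mul_of_nonneg_left (hφ s hs) hs0
      _ ≤ t₂ * φ s := mul_le_mul_of_nonneg_right hs.2 (hφ0 s hs.1)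
  have h2 : ∫ s in Ioc t₁ t₂, φ s ≤ ∫ s in Ioi t₁, φ s :=
    setIntegral_mono_set hφi (ae_restrict_of_forall_mem measurableSet_Ioi hφ0) (ae_of_all _ Ioc_subset_Ioi_self)
  rw [integral_const_mul] at h1
  exact h1.trans (mul_le_mul_of_nonneg_left h2 ht₂)

/-- **Comparison for the remaining tail**: if `|C_N| ≤ φ` on `(t,∞)` (`t ≥ 0`) with `φ` integrable there, then `t·R_N(t) ≤ t·∫_{(t,∞)} φ`. [folklore] -/
theorem mul_gkRemainder_le_of_abs_le {N : ℕ} (hN : 0 < N) {t : ℝ} (ht : 0 ≤ t) {φ : ℝ → ℝ}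
    (hφi : IntegrableOn φ (Ioi t)) (hφ : ∀ s ∈ Ioi t, |totalAutocorr ω₂ lam β γ T N s| ≤ φ s) :
    t * gkRemainder ω₂ lam β γ T N t ≤ t * ∫ s in Ioi t, φ s := by
  refine mul_le_mul_of_nonneg_left ?_ ht
  unfold gkRemainder
  exact setIntegral_mono_on ((integrableOn_totalAutocorr hω hl hβ hγ hT hN).mono_set (Ioi_subset_Ioi ht)) hφi measurableSet_Ioi
    fun s hs => (le_abs_self _).trans (hφ s hs)

end FixedN

end Summit.AtomisticToContinuum.FouriersLaw.Theorems.BoundedResponse.HeatSpreading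

end
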